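import Summits.BirchSwinnertonDyer.Rank1Residual.P2.CongruentNumberThetaDescentBlocks
import Summits.BirchSwinnertonDyer.Rank1Residual.P2.CongruentNumberThetaDescentCore
import Summits.BirchSwinnertonDyer.Rank1Residual.P2.DecompositionsThreePrimes
import Summits.BirchSwinnertonDyer.Rank1Residual.P2.CongruentNumberPairsAtTwoEvenThreePrimesDoor
import HarnessLib
import HarnessLib.Audit.Tags

/-!
# Cell «bsd-monsky» (prover-B): route B's operator `θ` at `k = 3` — THEOREM B₃ for the type `(5, 5, 7)`:
# `n = 2p₁p₂p₃`, `p₁ ≡ p₂ ≡ 5`, `p₃ ≡ 7 (mod 8)` ⟹ [`g(n) − 𝓛(p₁p₂)·g(2p₃)` odd ⟹ `𝓛(n)` odd], relative to the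
# Literature display `tyz_cmPointGaloisData` and a rank input (kernel theorem; nothing asserted, nothing booked)

HONEST FRAMING (cell `bsd-monsky`, run/shared/lean/pub/bsd-monsky/; README §1/§3): the cell's CLAIMED theorem is Monsky's
1990 conjecture on the `k = 2` family `𝒮⁻`; «ℓ ≥ 3 rungs (C-P2-2 for k ≥ 3) are NOT claimed — record what the same argument
gives there, no more». THIS FILE IS THAT RECORD IN THE KERNEL for the simplest `θ`-controlled `k = 3` type of the scope note
HOME/proof/PROOF-B-K3-SCOPE.md (prover-B g6; census kit j246343: type `[5,5,7]`). Nothing is asserted: every statement is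
CONDITIONAL on TYZ data `D` with the displayed printed sentences (`D.Printed`, `D.CMPointGaloisPrinted` — the hypotheses
the Literature named fact `tyz_cmPointGaloisData` provides) and on a rank input (GZK by name); no conjecture is discharged,
no count moves, no class is booked. NOT refereed; not part of PROOF-B v1.3 or of the paper.

THE TYPE. Primes `p₁ ≡ p₂ ≡ 5 (mod 8)` (`p₁ ≠ p₂`), `p₃ ≡ 7 (mod 8)`, `m = p₁p₂p₃ ≡ 7`, `n = 2m ≡ 6 (mod 8)`. TYZ's recursion
(`GenusPointData.recursion`, §3.1 p0011 L67–L70) has SIX blocks: `R(n) = {p₃, 2p₃, m}` (cofactors `2p₁p₂ ≡ 2`, `p₁p₂ ≡ 1`,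
`2`), `R(2p₃) = {p₃}`, `R(m) = {p₁, p₂, p₃}` (cofactors `p₂p₃ ≡ 3`, `p₁p₃ ≡ 3` — the `(5,3)`-steps with `ε = ±i` — and
`p₁p₂ ≡ 1`), `R(pᵢ) = ∅` (§2). With `θ = θ^{(n)}` the top block's lift of `σ_{1+ϖ}` (display (G8)):
(E6) `(θ−1)Z(n) ∈ g(n)w + ℤτ(1)` and `(θ−1)Z(2p₃) ∈ g(2p₃)w + ℤτ(1)` (`w = τ((1−i)/2)`; the sub-block by comparing `θ` with
the block's own lift `θ^{(2p₃)}` — `θ·(θ^{(2p₃)})⁻¹` is trivial on `L_{2p₃}(i) = ℚ(i, √2, √−p₃)`, J759); (E7) `θ` fixes `Z(p₃)`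
and `Z(m)` (Prop. 3.2 (3): `Z ∈ A(L_d)`, and `θ` is trivial on the genus field of `K_n`, which contains `L_{p₃}`, `L_m`);
(E5) `θZ(pᵢ) + Z(pᵢ) ∈ ℤτ(1)` for `i = 1, 2` (`θc` trivial on `L_{pᵢ}(i)`; PROOF-B (B3) = `reflection_sum_thetaPt`); the odd
powers of `[i]` at the `(5,3)`-steps turn `θ − 1` into `−[i](θ + 1)`. Hence (§4)
  `(θ − 1)P(n) = (g(n) − 𝓛(p₁p₂)·g(2p₃))·w + M·τ(1)`,
and the general descent core (`odd_scriptL_of_theta_rec`, file `…ThetaDescentCore`) gives THEOREM B₃ (companion file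
`P2/CongruentNumberThetaThreePrimesDescent.lean`; THIS file: §1 the arithmetic of the type and its recursion index sets, §2 the
`θ`-evaluation package (E5)/(E6)/(E7) from the display):
  `g(n) − 𝓛(p₁p₂)·g(2p₃)` odd ⟹ `𝓛(n)` odd ⟹ `ord_{s=1} L(E_n, s) = 1`.
(`g(2p₃)` is even for `p₃ ≡ 7 (mod 8)` — Rédei; proved in the companion family file, where the hypothesis becomes `g(n)` odd
and is evaluated on Legendre symbols, and `BSD(E_n, 2)` follows through the landed even door.) The parity of TYZ's `Σ₂′(n)`
is NOT used: on the sub-family where `g(n)` is odd and `Σ₂′(n)` is even (census types `[5,5,7]/[0,1,0]`, `[0,0,1]`, smallest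
members `2030`, `8990`) no printed theorem decides `ord_{s=1} L(E_n, s)`; this file's theorem does, relative to the display.

References: [TianYuanZhang2017] §3.1 (J738–J739), Prop. 3.2 (1)(2)(3), Thm. 3.3 (ε), Thm. 3.5, Thm. 3.6 (1)(2) (J741),
Lemma 3.18, proofs of Lemma 3.15 (J750) and Lemma 3.21 (J759); HOME/proof/PROOF-B.md v1.3 §4–§8, §10;
HOME/proof/PROOF-B-K3-SCOPE.md §2–§4.
-/

noncomputable section

open scoped Classical

open WeierstrassCurve WeierstrassCurve.Affine Literature.NumberTheory.EllipticCurves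
  Literature.NumberTheory.EllipticCurves.Rank1Residual
  Literature.NumberTheory.EllipticCurves.Rank1Residual.Typed
  Literature.NumberTheory.EllipticCurves.HeathBrown1994
  Literature.NumberTheory.EllipticCurves.Tian2014
  Literature.NumberTheory.EllipticCurves.TianYuanZhang2017
  Literature.NumberTheory.EllipticCurves.TianYuanZhang2017.W2
  Literature.NumberTheory.QuadraticFields.RedeiReichardt

set_option autoImplicit false

namespace Summit.BirchSwinnertonDyer.Rank1Residual.P2

namespace ThetaDescent

variable {n : ℕ}

/-! ## §1 Arithmetic of the type `(5, 5, 7)`: divisors, residues, the recursion index sets -/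

section Arith

variable {p₁ p₂ p₃ : ℕ}

/-- Divisors of `2·(abc)` for odd primes `a, b, c`: `δ` or `2δ` with `δ ∣ abc`. [cite: HardyWright2008, §1.3 Thm. 2] -/
theorem dvd_two_mul_three_iff {a b c d : ℕ} (ha : a.Prime) (hb : b.Prime) (hc : c.Prime) :
    d ∣ 2 * (a * b * c) ↔ (d = 1 ∨ d = a ∨ d = b ∨ d = c ∨ d = a * b ∨ d = a * c ∨ d = b * c ∨ d = a * b * c) ∨
      (d = 2 ∨ d = 2 * a ∨ d = 2 * b ∨ d = 2 * c ∨ d = 2 * (a * b) ∨ d = 2 * (a * c) ∨ d = 2 * (b * c) ∨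
        d = 2 * (a * b * c)) := by
  constructor
  · intro h
    obtain ⟨y, z, hy, hz, rfl⟩ := dvd_mul.mp h
    have hz' := (dvd_mul_three_iff ha hb hc).mp hz
    rcases (Nat.dvd_prime Nat.prime_two).mp hy with rfl | rfl
    · left; simpa only [one_mul] using hz'
    · right
      rcases hz' with rfl | rfl | rfl | rfl | rfl | rfl | rfl | rfl <;> simp
  · rintro (h | h)
    · rcases h with rfl | rfl | rfl | rfl | rfl | rfl | rfl | rfl
      · exact one_dvd _
      · exact Dvd.intro (2 * (b * c)) (by ring)
      · exact Dvd.intro (2 * (a * c)) (by ring)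
      · exact Dvd.intro (2 * (a * b)) (by ring)
      · exact Dvd.intro (2 * c) (by ring)
      · exact Dvd.intro (2 * b) (by ring)
      · exact Dvd.intro (2 * a) (by ring)
      · exact Dvd.intro 2 (by ring)
    · rcases h with rfl | rfl | rfl | rfl | rfl | rfl | rfl | rfl
      · exact Dvd.intro (a * b * c) (by ring)
      · exact Dvd.intro (b * c) (by ring)
      · exact Dvd.intro (a * c) (by ring)
      · exact Dvd.intro (a * b) (by ring)
      · exact Dvd.intro c (by ring)
      · exact Dvd.intro b (by ring)
      · exact Dvd.intro a (by ring)
      · exact dvd_rfl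

/-- `recursionIndex (2p) = {p}` for a prime `p ≡ 7 (mod 8)` (type `(7, 2)`). [cite: TianYuanZhang2017, §3.1 (p0011 L67–L70)] -/
theorem recursionIndex_two_mul_seven (hp : p₃.Prime) (h7 : p₃ % 8 = 7) : recursionIndex (2 * p₃) = {p₃} := by
  have hp2 : p₃ ≠ 2 := by omega
  have e2 : 2 * p₃ / p₃ = 2 := Nat.mul_div_cancel 2 hp.pos
  ext d₀
  simp only [recursionIndex, Finset.mem_filter, Nat.mem_divisors, Finset.mem_singleton]
  constructor
  · rintro ⟨⟨hd, -⟩, h567, h123, hgt⟩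
    rcases (dvd_prime_mul_prime_iff Nat.prime_two hp).mp hd with rfl | rfl | rfl | rfl
    · omega
    · omega
    · rfl
    · rw [Nat.div_self (by omega)] at hgt; omega
  · rintro rfl
    refine ⟨⟨Dvd.intro_left 2 rfl, by omega⟩, Or.inr (Or.inr h7), ?_, ?_⟩
    · rw [e2]; omega
    · rw [e2]; omega

/-- `d₀ ∈ recursionIndex (p₁p₂p₃)` ⟹ `d₀ ∈ {p₁, p₂, p₃}` for the type `(5, 5, 7)` (`m ≡ 7`; cofactors `p₂p₃ ≡ 3`, `p₁p₃ ≡ 3`,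
`p₁p₂ ≡ 1`; the blocks `pᵢpⱼ ≡ 1, 3` are not `≡ 5, 6, 7`). [cite: TianYuanZhang2017, §3.1 (p0011 L67–L70)] -/
theorem mem_recursionIndex_m (hp₁ : p₁.Prime) (hp₂ : p₂.Prime) (hp₃ : p₃.Prime) (h₁ : p₁ % 8 = 5) (h₂ : p₂ % 8 = 5)
    (h₃ : p₃ % 8 = 7) {d₀ : ℕ} (hd₀ : d₀ ∈ recursionIndex (p₁ * p₂ * p₃)) : d₀ = p₁ ∨ d₀ = p₂ ∨ d₀ = p₃ := by
  have h12 : (p₁ * p₂) % 8 = 1 := by rw [Nat.mul_mod, h₁, h₂]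
  have h13 : (p₁ * p₃) % 8 = 3 := by rw [Nat.mul_mod, h₁, h₃]
  have h23 : (p₂ * p₃) % 8 = 3 := by rw [Nat.mul_mod, h₂, h₃]
  have hm0 : p₁ * p₂ * p₃ ≠ 0 := Nat.mul_ne_zero (Nat.mul_ne_zero hp₁.ne_zero hp₂.ne_zero) hp₃.ne_zero
  simp only [recursionIndex, Finset.mem_filter, Nat.mem_divisors] at hd₀
  obtain ⟨⟨hd, -⟩, h567, h123, hgt⟩ := hd₀
  rcases (dvd_mul_three_iff hp₁ hp₂ hp₃).mp hd with rfl | rfl | rfl | rfl | rfl | rfl | rfl | rfl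
  · omega
  · exact Or.inl rfl
  · exact Or.inr (Or.inl rfl)
  · exact Or.inr (Or.inr rfl)
  · omega
  · omega
  · omega
  · rw [Nat.div_self (Nat.pos_of_ne_zero hm0)] at hgt; omega

/-- `d₀ ∈ recursionIndex (2p₁p₂p₃)` ⟹ `d₀ ∈ {p₃, 2p₃, p₁p₂p₃}` for the type `(5, 5, 7)` (the sixteen divisors; only the cofactors
`2p₁p₂ ≡ 2`, `p₁p₂ ≡ 1`, `2` are `≡ 1, 2, 3` against a block `≡ 5, 6, 7`). [cite: TianYuanZhang2017, §3.1 (p0011 L67–L70)] -/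
theorem mem_recursionIndex_n (hp₁ : p₁.Prime) (hp₂ : p₂.Prime) (hp₃ : p₃.Prime) (h₁ : p₁ % 8 = 5) (h₂ : p₂ % 8 = 5)
    (h₃ : p₃ % 8 = 7) {d₀ : ℕ} (hd₀ : d₀ ∈ recursionIndex (2 * (p₁ * p₂ * p₃))) :
    d₀ = p₃ ∨ d₀ = 2 * p₃ ∨ d₀ = p₁ * p₂ * p₃ := by
  have h12 : (p₁ * p₂) % 8 = 1 := by rw [Nat.mul_mod, h₁, h₂]
  have h13 : (p₁ * p₃) % 8 = 3 := by rw [Nat.mul_mod, h₁, h₃]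
  have h23 : (p₂ * p₃) % 8 = 3 := by rw [Nat.mul_mod, h₂, h₃]
  have hm7 : (p₁ * p₂ * p₃) % 8 = 7 := by rw [Nat.mul_mod, h12, h₃]
  have hn0 : 2 * (p₁ * p₂ * p₃) ≠ 0 :=
    Nat.mul_ne_zero two_ne_zero (Nat.mul_ne_zero (Nat.mul_ne_zero hp₁.ne_zero hp₂.ne_zero) hp₃.ne_zero)
  have ep₁ : 2 * (p₁ * p₂ * p₃) / p₁ = 2 * (p₂ * p₃) := by
    rw [show 2 * (p₁ * p₂ * p₃) = p₁ * (2 * (p₂ * p₃)) by ring]; exact Nat.mul_div_cancel_left _ hp₁.pos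
  have ep₂ : 2 * (p₁ * p₂ * p₃) / p₂ = 2 * (p₁ * p₃) := by
    rw [show 2 * (p₁ * p₂ * p₃) = p₂ * (2 * (p₁ * p₃)) by ring]; exact Nat.mul_div_cancel_left _ hp₂.pos
  have e2p₁ : 2 * (p₁ * p₂ * p₃) / (2 * p₁) = p₂ * p₃ := by
    rw [show 2 * (p₁ * p₂ * p₃) = (2 * p₁) * (p₂ * p₃) by ring]; exact Nat.mul_div_cancel_left _ (by omega)
  have e2p₂ : 2 * (p₁ * p₂ * p₃) / (2 * p₂) = p₁ * p₃ := by
    rw [show 2 * (p₁ * p₂ * p₃) = (2 * p₂) * (p₁ * p₃) by ring]; exact Nat.mul_div_cancel_left _ (by omega)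
  have e2p₁p₃ : 2 * (p₁ * p₂ * p₃) / (2 * (p₁ * p₃)) = p₂ := by
    rw [show 2 * (p₁ * p₂ * p₃) = (2 * (p₁ * p₃)) * p₂ by ring]
    exact Nat.mul_div_cancel_left _ (Nat.mul_pos two_pos (Nat.mul_pos hp₁.pos hp₃.pos))
  have e2p₂p₃ : 2 * (p₁ * p₂ * p₃) / (2 * (p₂ * p₃)) = p₁ := by
    rw [show 2 * (p₁ * p₂ * p₃) = (2 * (p₂ * p₃)) * p₁ by ring]
    exact Nat.mul_div_cancel_left _ (Nat.mul_pos two_pos (Nat.mul_pos hp₂.pos hp₃.pos))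
  simp only [recursionIndex, Finset.mem_filter, Nat.mem_divisors] at hd₀
  obtain ⟨⟨hd, -⟩, h567, h123, hgt⟩ := hd₀
  rcases (dvd_two_mul_three_iff hp₁ hp₂ hp₃).mp hd with
    (rfl | rfl | rfl | rfl | rfl | rfl | rfl | rfl) | (rfl | rfl | rfl | rfl | rfl | rfl | rfl | rfl)
  · omega
  · rw [ep₁] at h123; omega
  · rw [ep₂] at h123; omega
  · exact Or.inl rfl
  · omega
  · omega
  · omega
  · exact Or.inr (Or.inr rfl)
  · omega
  · rw [e2p₁] at h123; omega
  · rw [e2p₂] at h123; omega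
  · exact Or.inr (Or.inl rfl)
  · omega
  · rw [e2p₁p₃] at h123; omega
  · rw [e2p₂p₃] at h123; omega
  · rw [Nat.div_self (Nat.pos_of_ne_zero hn0)] at hgt; omega

/-- `2p₃ ∈ recursionIndex (2p₁p₂p₃)` (cofactor `p₁p₂ ≡ 1`). [cite: TianYuanZhang2017, §3.1 (p0011 L67–L70)] -/
theorem two_mul_mem_recursionIndex_n (hp₁ : p₁.Prime) (hp₂ : p₂.Prime) (hp₃ : p₃.Prime) (h₁ : p₁ % 8 = 5)
    (h₂ : p₂ % 8 = 5) (h₃ : p₃ % 8 = 7) : 2 * p₃ ∈ recursionIndex (2 * (p₁ * p₂ * p₃)) := by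
  have h12 : (p₁ * p₂) % 8 = 1 := by rw [Nat.mul_mod, h₁, h₂]
  have hn0 : 2 * (p₁ * p₂ * p₃) ≠ 0 :=
    Nat.mul_ne_zero two_ne_zero (Nat.mul_ne_zero (Nat.mul_ne_zero hp₁.ne_zero hp₂.ne_zero) hp₃.ne_zero)
  have e : 2 * (p₁ * p₂ * p₃) / (2 * p₃) = p₁ * p₂ := by
    rw [show 2 * (p₁ * p₂ * p₃) = (2 * p₃) * (p₁ * p₂) by ring]; exact Nat.mul_div_cancel_left _ (by omega)
  simp only [recursionIndex, Finset.mem_filter, Nat.mem_divisors]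
  refine ⟨⟨Dvd.intro (p₁ * p₂) (by ring), hn0⟩, Or.inr (Or.inl (by omega)), ?_, ?_⟩
  · rw [e]; omega
  · rw [e]; have := Nat.mul_le_mul hp₁.two_le hp₂.two_le; omega

end Arith

/-! ## §2 The block evaluations (E5), (E6), (E7) at `n = 2p₁p₂p₃` from the Literature display, and `θ`'s values -/

section Blocks

variable {p₁ p₂ p₃ : ℕ}

/-- **The `θ`-evaluation package of the type `(5, 5, 7)`.** From `D.CMPointGaloisPrinted` (TYZ §3.1–3.2 / Prop. 3.2 / Thm. 3.6 /
p. 759, every block): the top block's lift `θ = θ^{(n)}` of `σ_{1+ϖ}` satisfies `θ(√−n) = √−n`, `θ(i) = −i`, `θ(√−2) = −√−2`,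
and the block evaluations (E6) at `n` and `2p₃`, (E7) at `p₃` and `m = p₁p₂p₃`, (E5) at `p₁` and `p₂`.
[cite: TianYuanZhang2017, §3.1 (J738–J739), Prop. 3.2 (1)(2)(3), Thm. 3.6 (1)(2) (J741), proof of Lemma 3.21 (J759), proof of Lemma 3.15 (J750)] -/
theorem theta_package_557 (hp₁ : p₁.Prime) (hp₂ : p₂.Prime) (hp₃ : p₃.Prime) (h₁ : p₁ % 8 = 5) (h₂ : p₂ % 8 = 5)
    (h₃ : p₃ % 8 = 7) (D : GenusPointData (2 * (p₁ * p₂ * p₃))) (hG : D.CMPointGaloisPrinted) :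
    ∃ θ : D.H ≃ₐ[ℚ] D.H,
      θ (D.sqrtNeg (2 * (p₁ * p₂ * p₃))) = D.sqrtNeg (2 * (p₁ * p₂ * p₃)) ∧ θ D.im = -D.im ∧
      θ (D.sqrtNeg 2) = -D.sqrtNeg 2 ∧
      (∃ M : ℤ, thetaPt D θ (D.Z (2 * (p₁ * p₂ * p₃))) - D.Z (2 * (p₁ * p₂ * p₃)) =
        (gK (2 * (p₁ * p₂ * p₃)) : ℤ) • D.tauHalfOneMinusI + M • tauOne) ∧
      (∃ M : ℤ, thetaPt D θ (D.Z (2 * p₃)) - D.Z (2 * p₃) = (gK (2 * p₃) : ℤ) • D.tauHalfOneMinusI + M • tauOne) ∧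
      thetaPt D θ (D.Z p₃) = D.Z p₃ ∧ thetaPt D θ (D.Z (p₁ * p₂ * p₃)) = D.Z (p₁ * p₂ * p₃) ∧
      thetaPt D θ (D.Z p₁) + D.Z p₁ ∈ AddSubgroup.zmultiples (tauOne : APoint D.H) ∧
      thetaPt D θ (D.Z p₂) + D.Z p₂ ∈ AddSubgroup.zmultiples (tauOne : APoint D.H) := by
  obtain ⟨z, Φ, ΓH, ΓH', σ, θ, c, ⟨hci, hcd, hcc⟩, hblk⟩ := hG
  -- arithmetic
  have hp₁2 : p₁ ≠ 2 := by omega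
  have hp₂2 : p₂ ≠ 2 := by omega
  have hp₃2 : p₃ ≠ 2 := by omega
  have h13 : p₁ ≠ p₃ := fun h => by omega
  have h23 : p₂ ≠ p₃ := fun h => by omega
  have hp₁o : Odd p₁ := hp₁.odd_of_ne_two hp₁2
  have hp₂o : Odd p₂ := hp₂.odd_of_ne_two hp₂2
  have hp₃o : Odd p₃ := hp₃.odd_of_ne_two hp₃2
  have h12m : (p₁ * p₂) % 8 = 1 := by rw [Nat.mul_mod, h₁, h₂]
  have hm7 : (p₁ * p₂ * p₃) % 8 = 7 := by rw [Nat.mul_mod, h12m, h₃]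
  have hn6 : (2 * (p₁ * p₂ * p₃)) % 8 = 6 := by omega
  have h2p₃ : (2 * p₃) % 8 = 6 := by omega
  have hm0 : p₁ * p₂ * p₃ ≠ 0 := Nat.mul_ne_zero (Nat.mul_ne_zero hp₁.ne_zero hp₂.ne_zero) hp₃.ne_zero
  have hn0 : 2 * (p₁ * p₂ * p₃) ≠ 0 := Nat.mul_ne_zero two_ne_zero hm0
  -- memberships in `n.divisors`
  have hn : 2 * (p₁ * p₂ * p₃) ∈ (2 * (p₁ * p₂ * p₃)).divisors := Nat.mem_divisors_self _ hn0
  have h2n : 2 ∈ (2 * (p₁ * p₂ * p₃)).divisors := Nat.mem_divisors.mpr ⟨Dvd.intro _ rfl, hn0⟩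
  have hp₁n : p₁ ∈ (2 * (p₁ * p₂ * p₃)).divisors := Nat.mem_divisors.mpr ⟨Dvd.intro (2 * (p₂ * p₃)) (by ring), hn0⟩
  have hp₂n : p₂ ∈ (2 * (p₁ * p₂ * p₃)).divisors := Nat.mem_divisors.mpr ⟨Dvd.intro (2 * (p₁ * p₃)) (by ring), hn0⟩
  have hp₃n : p₃ ∈ (2 * (p₁ * p₂ * p₃)).divisors := Nat.mem_divisors.mpr ⟨Dvd.intro (2 * (p₁ * p₂)) (by ring), hn0⟩
  have h12n : p₁ * p₂ ∈ (2 * (p₁ * p₂ * p₃)).divisors := Nat.mem_divisors.mpr ⟨Dvd.intro (2 * p₃) (by ring), hn0⟩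
  have hmn : p₁ * p₂ * p₃ ∈ (2 * (p₁ * p₂ * p₃)).divisors := Nat.mem_divisors.mpr ⟨Dvd.intro 2 (by ring), hn0⟩
  have h2p₃n : 2 * p₃ ∈ (2 * (p₁ * p₂ * p₃)).divisors := Nat.mem_divisors.mpr ⟨Dvd.intro (p₁ * p₂) (by ring), hn0⟩
  -- genus roots
  have hgp₁ : D.genusRoot p₁ = D.im * D.sqrtNeg p₁ := by unfold GenusPointData.genusRoot; rw [if_pos (by omega)]
  have hgp₂ : D.genusRoot p₂ = D.im * D.sqrtNeg p₂ := by unfold GenusPointData.genusRoot; rw [if_pos (by omega)]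
  have hgp₃ : D.genusRoot p₃ = D.sqrtNeg p₃ := by unfold GenusPointData.genusRoot; rw [if_neg (by omega)]
  have hg12 : D.genusRoot (p₁ * p₂) = D.im * D.sqrtNeg (p₁ * p₂) := by
    unfold GenusPointData.genusRoot; rw [if_pos (by omega)]
  have hgm : D.genusRoot (p₁ * p₂ * p₃) = D.sqrtNeg (p₁ * p₂ * p₃) := by
    unfold GenusPointData.genusRoot; rw [if_neg (by omega)]
  -- squares
  have sq_n := D.sqrtNeg_sq _ hn
  have sq_2 := D.sqrtNeg_sq _ h2n
  have sq_p₃ := D.sqrtNeg_sq _ hp₃n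
  have sq_12 := D.sqrtNeg_sq _ h12n
  have sq_m := D.sqrtNeg_sq _ hmn
  have sq_2p₃ := D.sqrtNeg_sq _ h2p₃n
  have him0 : D.im ≠ 0 := im_ne_zero D
  -- the top block `n`
  obtain ⟨hBn, hTn, -⟩ := hblk _ hn
  have hBn' := hBn (Or.inr hn6)
  have hTn' := hTn hn6
  obtain ⟨⟨-, -⟩, -, ⟨hΓn'z, -, -⟩, ⟨-, hΓngen⟩, -, ⟨-, -, hσnz⟩, -⟩ := hBn'
  obtain ⟨hθK, ⟨m₀, h36⟩, hθH, hθθσ⟩ := hTn'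
  set Θ := θ (2 * (p₁ * p₂ * p₃)) with hΘdef
  -- `Θ(i) = −i`
  have hΘsq : thetaPt D Θ (thetaPt D Θ (z (2 * (p₁ * p₂ * p₃)))) = z (2 * (p₁ * p₂ * p₃)) + tauOne := by
    have hmul : Θ * Θ = Θ * Θ * (σ (2 * (p₁ * p₂ * p₃)))⁻¹ * σ (2 * (p₁ * p₂ * p₃)) := by group
    rw [← thetaPt_mul, hmul, thetaPt_mul]
    show thetaPt D _ (D.galPt (σ _) (z _)) = _
    rw [hσnz, map_add, (thetaPt_tauOne_tauHalf D _).1]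
    show D.galPt _ (z _) + tauOne = _
    rw [hΓn'z _ hθθσ]
  have hΘi : Θ D.im = -D.im := theta_im_eq_neg_of_thm36 D Θ (z (2 * (p₁ * p₂ * p₃))) m₀ h36 hΘsq
  -- `Θ` on the genus field of `K_n`
  obtain ⟨-, hΘgen⟩ := hΓngen Θ hθH
  have hΘrp₁ : Θ (D.im * D.sqrtNeg p₁) = D.im * D.sqrtNeg p₁ := by rw [← hgp₁]; exact hΘgen p₁ hp₁n hp₁o hp₁.one_lt
  have hΘrp₂ : Θ (D.im * D.sqrtNeg p₂) = D.im * D.sqrtNeg p₂ := by rw [← hgp₂]; exact hΘgen p₂ hp₂n hp₂o hp₂.one_lt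
  have hΘp₃ : Θ (D.sqrtNeg p₃) = D.sqrtNeg p₃ := by rw [← hgp₃]; exact hΘgen p₃ hp₃n hp₃o hp₃.one_lt
  have hΘr12 : Θ (D.im * D.sqrtNeg (p₁ * p₂)) = D.im * D.sqrtNeg (p₁ * p₂) := by
    rw [← hg12]
    exact hΘgen (p₁ * p₂) h12n (hp₁o.mul hp₂o) (by have := Nat.mul_le_mul hp₁.two_le hp₂.two_le; omega)
  have hΘm : Θ (D.sqrtNeg (p₁ * p₂ * p₃)) = D.sqrtNeg (p₁ * p₂ * p₃) := by
    rw [← hgm]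
    exact hΘgen _ hmn ((hp₁o.mul hp₂o).mul hp₃o)
      (by have := Nat.mul_le_mul (Nat.mul_le_mul hp₁.two_le hp₂.two_le) hp₃.two_le; omega)
  -- `Θ(√−2) = −√−2`: `(√−m·√−2)² = 2m = (i√−n)²`, `Θ(i√−n) = −i√−n`, `Θ(√−m) = √−m`
  have hΘ2 : Θ (D.sqrtNeg 2) = -D.sqrtNeg 2 := by
    have hsq : (D.sqrtNeg (p₁ * p₂ * p₃) * D.sqrtNeg 2) ^ 2 = (D.im * D.sqrtNeg (2 * (p₁ * p₂ * p₃))) ^ 2 := by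
      rw [mul_pow, mul_pow, D.im_sq, sq_m, sq_2, sq_n]; push_cast; ring
    have hy : Θ (D.im * D.sqrtNeg (2 * (p₁ * p₂ * p₃))) = -(D.im * D.sqrtNeg (2 * (p₁ * p₂ * p₃))) := by
      rw [map_mul, hΘi, hθK]; ring
    have hxy := neg_of_sq_eq_sq D Θ hsq hy
    exact neg_of_neg_mul_left D Θ (sqrtNeg_ne_zero D hmn) hΘm hxy
  -- `Θ` fixes `√−2p₃`: `(i√−p₁p₂ · √−2p₃)² = (√−n)²`
  have hΘ2p₃ : Θ (D.sqrtNeg (2 * p₃)) = D.sqrtNeg (2 * p₃) := by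
    have hsq : (D.im * D.sqrtNeg (p₁ * p₂) * D.sqrtNeg (2 * p₃)) ^ 2 = D.sqrtNeg (2 * (p₁ * p₂ * p₃)) ^ 2 := by
      rw [mul_pow, mul_pow, D.im_sq, sq_12, sq_2p₃, sq_n]; push_cast; ring
    have hfix := fix_of_sq_eq_sq D Θ hsq hθK
    exact fix_of_fix_mul_left D Θ (mul_ne_zero him0 (sqrtNeg_ne_zero D h12n)) hΘr12 hfix
  refine ⟨Θ, hθK, hΘi, hΘ2, ?_, ?_, ?_, ?_, ?_, ?_⟩
  · -- (E6) at the top block: `α = 1`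
    have h1 : (2 * (p₁ * p₂ * p₃)) ∈ (2 * (p₁ * p₂ * p₃)).divisors := hn
    exact theta_sub_Z_of_six_block D h1 (by omega) (hBn (Or.inr hn6)) (hTn hn6) Θ hθK
      (by rw [mul_inv_cancel]; exact ⟨rfl, fun _ _ _ => rfl⟩)
  · -- (E6) at the block `2p₃`: compare `Θ` with `θ^{(2p₃)}`
    obtain ⟨hB2, hT2, -⟩ := hblk _ h2p₃n
    have hB2' := hB2 (Or.inr h2p₃)
    have hT2' := hT2 h2p₃
    obtain ⟨⟨-, -⟩, -, ⟨hΓ2'z, -, -⟩, ⟨-, hΓ2gen⟩, -, ⟨-, -, hσ2z⟩, -⟩ := hB2'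
    obtain ⟨hθ₂K, ⟨m₂, h36₂⟩, hθ₂H, hθθσ₂⟩ := hT2'
    set θ₂ := θ (2 * p₃) with hθ₂def
    have hθ₂sq : thetaPt D θ₂ (thetaPt D θ₂ (z (2 * p₃))) = z (2 * p₃) + tauOne := by
      have hmul : θ₂ * θ₂ = θ₂ * θ₂ * (σ (2 * p₃))⁻¹ * σ (2 * p₃) := by group
      rw [← thetaPt_mul, hmul, thetaPt_mul]
      show thetaPt D _ (D.galPt (σ _) (z _)) = _
      rw [hσ2z, map_add, (thetaPt_tauOne_tauHalf D _).1]
      show D.galPt _ (z _) + tauOne = _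
      rw [hΓ2'z _ hθθσ₂]
    have hθ₂i : θ₂ D.im = -D.im := theta_im_eq_neg_of_thm36 D θ₂ (z (2 * p₃)) m₂ h36₂ hθ₂sq
    obtain ⟨-, hθ₂gen⟩ := hΓ2gen θ₂ hθ₂H
    have hp₃d : p₃ ∈ (2 * p₃).divisors := Nat.mem_divisors.mpr ⟨Dvd.intro_left 2 rfl, by omega⟩
    have hθ₂p₃ : θ₂ (D.sqrtNeg p₃) = D.sqrtNeg p₃ := by rw [← hgp₃]; exact hθ₂gen p₃ hp₃d hp₃o hp₃.one_lt
    -- both `Θ` and `θ₂` negate `√−2`: `(√−p₃·√−2)² = (i√−2p₃)²`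
    have hsq2 : (D.sqrtNeg p₃ * D.sqrtNeg 2) ^ 2 = (D.im * D.sqrtNeg (2 * p₃)) ^ 2 := by
      rw [mul_pow, mul_pow, D.im_sq, sq_p₃, sq_2, sq_2p₃]; push_cast; ring
    have hθ₂2 : θ₂ (D.sqrtNeg 2) = -D.sqrtNeg 2 := by
      have hy : θ₂ (D.im * D.sqrtNeg (2 * p₃)) = -(D.im * D.sqrtNeg (2 * p₃)) := by
        rw [map_mul, hθ₂i, hθ₂K]; ring
      exact neg_of_neg_mul_left D θ₂ (sqrtNeg_ne_zero D hp₃n) hθ₂p₃ (neg_of_sq_eq_sq D θ₂ hsq2 hy)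
    -- `α = Θ θ₂⁻¹` is trivial on `L_{2p₃}(i) = ℚ(i, √−2, √−p₃, √−2p₃)`
    have hα : D.TrivialOnL (2 * p₃) (Θ * θ₂⁻¹) := by
      refine ⟨?_, ?_⟩
      · rw [AlgEquiv.mul_apply, inv_apply_eq_neg_of_apply_eq_neg D θ₂ hθ₂i, map_neg, hΘi, neg_neg]
      · intro d' hd' hd'1
        rw [AlgEquiv.mul_apply]
        rcases (dvd_prime_mul_prime_iff Nat.prime_two hp₃).mp (Nat.mem_divisors.mp hd').1 with rfl | rfl | rfl | rfl
        · omega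
        · rw [inv_apply_eq_neg_of_apply_eq_neg D θ₂ hθ₂2, map_neg, hΘ2, neg_neg]
        · rw [inv_apply_of_apply_eq D θ₂ _ hθ₂p₃, hΘp₃]
        · rw [inv_apply_of_apply_eq D θ₂ _ hθ₂K, hΘ2p₃]
    have hdd : 2 * p₃ ∈ (2 * p₃).divisors := Nat.mem_divisors_self _ (by omega)
    exact theta_sub_Z_of_six_block D hdd (by omega) (hB2 (Or.inr h2p₃)) (hT2 h2p₃) Θ hΘ2p₃ hα
  · -- (E7) at `p₃`
    obtain ⟨-, -, hS⟩ := hblk _ hp₃n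
    refine hS h₃ Θ ⟨hΘp₃, ?_⟩
    intro d' hd' _ hd'1
    rcases (Nat.dvd_prime hp₃).mp (Nat.mem_divisors.mp hd').1 with rfl | rfl
    · omega
    · rw [hgp₃]; exact hΘp₃
  · -- (E7) at `m = p₁p₂p₃`: every odd divisor of `m` is an odd divisor of `n`
    obtain ⟨-, -, hS⟩ := hblk _ hmn
    refine hS hm7 Θ ⟨hΘm, ?_⟩
    intro d' hd' hd'o hd'1
    have hd'n : d' ∈ (2 * (p₁ * p₂ * p₃)).divisors :=
      Nat.mem_divisors.mpr ⟨(Nat.mem_divisors.mp hd').1.trans (Dvd.intro_left 2 rfl), hn0⟩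
    exact hΘgen d' hd'n hd'o hd'1
  · -- (E5) at `p₁`
    exact theta_Z_add_Z_mem_of_five D hp₁ hp₁n h₁ ((hblk _ hp₁n).1 (Or.inl h₁)) hci (hcd p₁ hp₁n) hcc Θ hΘi hΘrp₁
  · -- (E5) at `p₂`
    exact theta_Z_add_Z_mem_of_five D hp₂ hp₂n h₂ ((hblk _ hp₂n).1 (Or.inl h₂)) hci (hcd p₂ hp₂n) hcc Θ hΘi hΘrp₂

end Blocks


end ThetaDescent

end Summit.BirchSwinnertonDyer.Rank1Residual.P2

end
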